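import Summits.Ventures.PercRepro.S1TrianglePlusFour
import Summits.Ventures.PercRepro.RankLevelSetPlaneSix

/-!
# PercRepro — the triangle caps at nullity `5` and `6` under the line and plane bounds (p2, gen 17)

Under (C1) (every rank-`2` set has `≤ 3` points) and (C2) (every set of rank `≤ 3` has `≤ 6` points) a finite
matroid of nullity `5` has at most `7` triangles and one of nullity `6` at most `10` — sharp on `M(K₅) ∖ e` and
`M(K₅)`. These are the two smallest entries of the cell's TRIANGLE CAP `P(ν)` (`P(5) = 7`, `P(6) = 10`, found by
exhaustive search on two seats; SUBCLAIM-S1 §6.3 (vi)), here as kernel theorems over p1's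
`ncard_triangles_le_five_of_nullity_four` (`T(4) = 5`) and the degree lemma `ncard_triangles_le_succ_of_degree`.

PROOF (nullity `5`; nullity `6` is the same argument one step up). A coloop lies on no triangle and its deletion
keeps the nullity, so by induction on `|E|` the matroid is coloop-free. Suppose `s₃ ≥ 8`. For every `x ∈ E` the
deletion `M ＼ {x}` has nullity `4`, hence `≤ 5` triangles, so `x` lies on `t(x) ≥ 3` triangles; the degree lemma
forbids `t(x) ≥ 4` (then `s₃ ≤ 6`), so `s₃ ≤ 3 + 5 = 8`. Counting incidences, `3·|E| ≤ Σ_x t(x) = 3·s₃ ≤ 24`, so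
`|E| ≤ 8` and `r(E) = |E| − 5 ≤ 3`; by (C2) `|E| ≤ 6`, whence `r(E) ≤ 1` — but a triangle has rank `2`.
At nullity `6`: `s₃ ≥ 11` forces `t(x) ≥ 4` everywhere (`T(5) = 7`), the degree lemma forbids `t(x) ≥ 5`, so
`s₃ ≤ 11`, `4·|E| ≤ 3·s₃ ≤ 33`, `|E| ≤ 8`, `r(E) ≤ 2`, `|E| ≤ 6` by (C2), `r(E) ≤ 0` — no triangle at all.

* `mul_ncard_ground_le_three_mul_ncard_triangles` — the double count `k·|E| ≤ 3·s₃` when every point of `E` lies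
  on at least `k` triangles;
* `triangles_delete_eq_of_isColoop`, `encard_delete_eq_of_isColoop` — a coloop's deletion keeps the triangles and
  the nullity;
* `ncard_triangles_le_add_of_not_isColoop` — `s₃ ≤ t(x) + s₃(M ＼ {x})` for a non-coloop `x`, with the nullity of
  `M ＼ {x}` one less (the deletion step, packaged);
* **`ncard_triangles_le_seven_of_nullity_five`** — `s₃ ≤ 7` at nullity `5` under (C1), (C2);
* **`ncard_triangles_le_ten_of_nullity_six`** — `s₃ ≤ 10` at nullity `6` under (C1), (C2);
* `core_ncard_triangles_le_seven_of_nullity_five`, `core_ncard_triangles_le_ten_of_nullity_six` — the same on the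
  `e`-free core, in the set-builder vocabulary of `S1RowTwelve` (`{C | M.IsCircuit C ∧ C.ncard = 3}`).
Axioms: standard.
-/

open scoped Matroid

namespace PercRepro

namespace S1

open Set

variable {α : Type}

/-- **Double count, lower bound**: if every point of `E` lies on at least `k` triangles then `k·|E| ≤ 3·s₃`. -/
theorem mul_ncard_ground_le_three_mul_ncard_triangles (M : Matroid α) [M.Finite] (k : ℕ)
    (hdeg : ∀ x ∈ M.E, k ≤ (ThmN.trianglesThrough M x).ncard) :
    k * M.E.ncard ≤ 3 * (ThmN.triangles M).ncard := by
  classical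
  have hTfin : (ThmN.triangles M).Finite :=
    M.ground_finite.finite_subsets.subset (fun C hC => hC.1.subset_ground)
  set Tf : Finset (Set α) := hTfin.toFinset with hTf
  set Ef : Finset α := M.ground_finite.toFinset with hEf
  have hmemT : ∀ C, C ∈ Tf ↔ C ∈ ThmN.triangles M := fun C => Set.Finite.mem_toFinset hTfin
  have hmemE : ∀ x, x ∈ Ef ↔ x ∈ M.E := fun x => Set.Finite.mem_toFinset M.ground_finite
  -- the double sum of the incidence indicator
  have hswap : ∑ x ∈ Ef, ∑ C ∈ Tf, (if x ∈ C then 1 else 0) =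
      ∑ C ∈ Tf, ∑ x ∈ Ef, (if x ∈ C then 1 else 0) := Finset.sum_comm
  -- rows: every triangle has its `3` points in `E`
  have hrow : ∀ C ∈ Tf, ∑ x ∈ Ef, (if x ∈ C then 1 else 0) = 3 := by
    intro C hC
    rw [Finset.sum_boole, Nat.cast_id]
    have hCT : C ∈ ThmN.triangles M := (hmemT C).1 hC
    have hCfin : C.Finite := M.ground_finite.subset hCT.1.subset_ground
    have hfilter : (Ef.filter (fun x => x ∈ C)) = hCfin.toFinset := by
      ext x
      simp only [Finset.mem_filter, Set.Finite.mem_toFinset]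
      constructor
      · rintro ⟨-, hx⟩; exact hx
      · intro hx
        exact ⟨(hmemE x).2 (hCT.1.subset_ground hx), hx⟩
    rw [hfilter, ← Set.ncard_eq_toFinset_card C hCfin, hCT.2]
  -- columns: at least `k` triangles through each point
  have hcol : ∀ x ∈ Ef, k ≤ ∑ C ∈ Tf, (if x ∈ C then 1 else 0) := by
    intro x hx
    rw [Finset.sum_boole, Nat.cast_id]
    have hfilter : ((Tf.filter (fun C => x ∈ C)) : Set (Set α)) = ThmN.trianglesThrough M x := by
      ext C
      simp only [Finset.coe_filter, Set.mem_setOf_eq, hmemT, ThmN.triangles, ThmN.trianglesThrough]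
      tauto
    have hcard : (Tf.filter (fun C => x ∈ C)).card = (ThmN.trianglesThrough M x).ncard := by
      rw [← hfilter, Set.ncard_coe_finset]
    rw [hcard]
    exact hdeg x ((hmemE x).1 hx)
  have hleft : ∑ C ∈ Tf, ∑ x ∈ Ef, (if x ∈ C then 1 else 0) = 3 * (ThmN.triangles M).ncard := by
    rw [Finset.sum_congr rfl hrow, Finset.sum_const, smul_eq_mul, hTf,
      ← Set.ncard_eq_toFinset_card _ hTfin, mul_comm]
  have hright : k * M.E.ncard ≤ ∑ x ∈ Ef, ∑ C ∈ Tf, (if x ∈ C then 1 else 0) := by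
    calc k * M.E.ncard = ∑ _x ∈ Ef, k := by
          rw [Finset.sum_const, smul_eq_mul, hEf, ← Set.ncard_eq_toFinset_card _ M.ground_finite,
            mul_comm]
      _ ≤ ∑ x ∈ Ef, ∑ C ∈ Tf, (if x ∈ C then 1 else 0) := Finset.sum_le_sum hcol
  rw [← hleft, ← hswap]
  exact hright

/-- A coloop lies on no triangle: the triangles of `M ＼ {k}` are those of `M`. -/
theorem triangles_delete_eq_of_isColoop (M : Matroid α) {k : α} (hk : M.IsColoop k) :
    ThmN.triangles (M ＼ {k}) = ThmN.triangles M := by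
  rw [triangles_delete_eq]
  ext C
  simp only [Set.mem_setOf_eq]
  constructor
  · exact fun h => h.1
  · intro h
    exact ⟨h, hk.notMem_isCircuit h.1⟩

/-- Deleting a coloop keeps the nullity: `|E ∖ k| = r(M ＼ {k}) + d` when `|E| = r(M) + d`. -/
theorem encard_delete_eq_of_isColoop (M : Matroid α) [M.Finite] {k : α} (hk : M.IsColoop k) {d : ℕ}
    (hd : M.E.encard = M.eRank + d) : (M ＼ {k}).E.encard = (M ＼ {k}).eRank + d := by
  have hkE : k ∈ M.E := hk.mem_ground
  have h1 : (M.E \ {k}).encard + 1 = M.E.encard := Set.encard_sdiff_singleton_add_one hkE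
  have h2 : M.eRank = (M ＼ {k}).eRank + 1 := by
    have hins : M.eRk (insert k (M.E \ {k})) = M.eRk (M.E \ {k}) + 1 :=
      _root_.Matroid.eRk_insert_eq_add_one ⟨hkE, hk.notMem_closure_of_notMem (fun h => h.2 rfl)⟩
    rw [Set.insert_sdiff_singleton, Set.insert_eq_of_mem hkE] at hins
    rw [_root_.Matroid.eRank_def, hins, _root_.Matroid.eRank_def, _root_.Matroid.delete_ground,
      delete_singleton_eRk_eq (subset_refl _)]
  rw [_root_.Matroid.delete_ground]
  have h3 : (M.E \ {k}).encard + 1 = ((M ＼ {k}).eRank + d) + 1 := by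
    rw [h1, hd, h2]
    ring
  exact WithTop.add_right_cancel ENat.one_ne_top h3

/-- **The deletion step**: for a non-coloop `x ∈ E`, `M ＼ {x}` has nullity one less, keeps (C1) and (C2), and
`s₃(M) ≤ t(x) + s₃(M ＼ {x})`. -/
theorem ncard_triangles_le_add_of_not_isColoop (M : Matroid α) [M.Finite]
    (hC1 : ∀ L ⊆ M.E, M.eRk L = 2 → L.ncard ≤ 3) (hC2 : ∀ P ⊆ M.E, M.eRk P ≤ 3 → P.ncard ≤ 6)
    {d : ℕ} (hd : M.E.encard = M.eRank + ((d + 1 : ℕ) : ℕ∞)) {x : α} (hxE : x ∈ M.E)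
    (hne : ¬ M.IsColoop x) :
    (M ＼ {x}).E.encard = (M ＼ {x}).eRank + (d : ℕ∞) ∧
    (∀ L ⊆ (M ＼ {x}).E, (M ＼ {x}).eRk L = 2 → L.ncard ≤ 3) ∧
    (∀ P ⊆ (M ＼ {x}).E, (M ＼ {x}).eRk P ≤ 3 → P.ncard ≤ 6) ∧
    (ThmN.triangles M).ncard ≤ (ThmN.trianglesThrough M x).ncard + (ThmN.triangles (M ＼ {x})).ncard := by
  classical
  refine ⟨?_, ?_, ?_, ?_⟩
  · rw [_root_.Matroid.delete_ground]
    have h1 : (M.E \ {x}).encard + 1 = M.E.encard := Set.encard_sdiff_singleton_add_one hxE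
    have h2 : (M ＼ {x}).eRank = M.eRank :=
      PercRepro.Matroid.eRank_delete_singleton_of_not_isColoop hxE hne
    have h3 : (M.E \ {x}).encard + 1 = ((M ＼ {x}).eRank + (d : ℕ∞)) + 1 := by
      rw [h1, hd, h2]
      push_cast
      ring
    exact WithTop.add_right_cancel ENat.one_ne_top h3
  · intro L hL hr
    rw [_root_.Matroid.delete_ground] at hL
    rw [delete_singleton_eRk_eq hL] at hr
    exact hC1 L (hL.trans Set.sdiff_subset) hr
  · intro P hP hr
    rw [_root_.Matroid.delete_ground] at hP
    rw [delete_singleton_eRk_eq hP] at hr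
    exact hC2 P (hP.trans Set.sdiff_subset) hr
  · have hTfin : (ThmN.trianglesThrough M x).Finite :=
      M.ground_finite.finite_subsets.subset (fun C hC => hC.1.subset_ground)
    have hS'fin : (ThmN.triangles (M ＼ {x})).Finite :=
      (M ＼ {x}).ground_finite.finite_subsets.subset (fun C hC => hC.1.subset_ground)
    have hS'eq : ThmN.triangles (M ＼ {x}) = {C | C ∈ ThmN.triangles M ∧ x ∉ C} :=
      triangles_delete_eq M x
    have hsplit : ThmN.triangles M ⊆ ThmN.trianglesThrough M x ∪ ThmN.triangles (M ＼ {x}) := by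
      intro C hC
      by_cases h : x ∈ C
      · exact Or.inl ⟨hC.1, hC.2, h⟩
      · exact Or.inr (by rw [hS'eq]; exact ⟨hC, h⟩)
    calc (ThmN.triangles M).ncard
        ≤ (ThmN.trianglesThrough M x ∪ ThmN.triangles (M ＼ {x})).ncard :=
          Set.ncard_le_ncard hsplit (hTfin.union hS'fin)
      _ ≤ (ThmN.trianglesThrough M x).ncard + (ThmN.triangles (M ＼ {x})).ncard :=
          Set.ncard_union_le _ _

/-- **The rank of the ground set against a triangle**: if `|E| = r(E) + d`, `|E| ≤ d + 3` and (C2) holds, then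
`M` has no triangle with `r(E) ≤ 1`; packaged as: `|E| ≤ d + 3` and (C2) and a triangle give `d + 2 ≤ |E|`.
Concretely: from `|E| ≤ d + 3` (C2) gives `|E| ≤ 6`, so `r(E) ≤ 6 − d`; a triangle has rank `2 ≤ r(E)`. -/
theorem two_add_le_eRank_of_triangle (M : Matroid α) [M.Finite] {d : ℕ}
    (hd : M.E.encard = M.eRank + (d : ℕ∞)) {C : Set α} (hC : C ∈ ThmN.triangles M) :
    ∃ r : ℕ, M.eRank = (r : ℕ∞) ∧ M.E.ncard = r + d ∧ 2 ≤ r := by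
  obtain ⟨r, hr⟩ := ENat.ne_top_iff_exists.1 (PercRepro.Matroid.eRank_ne_top_of_finite M)
  refine ⟨r, hr.symm, ?_, ?_⟩
  · have h : ((M.E.ncard : ℕ) : ℕ∞) = ((r + d : ℕ) : ℕ∞) := by
      rw [M.ground_finite.cast_ncard_eq, hd, ← hr]
      norm_cast
    exact Nat.cast_injective h
  · have hCfin : C.Finite := M.ground_finite.subset hC.1.subset_ground
    have h := hC.1.eRk_add_one_eq
    rw [← hCfin.cast_ncard_eq, hC.2] at h
    have hle : M.eRk C ≤ M.eRank := M.eRk_le_eRank C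
    obtain ⟨c, hc⟩ := ENat.ne_top_iff_exists.1
      (ne_top_of_le_ne_top (PercRepro.Matroid.eRank_ne_top_of_finite M) hle)
    rw [← hc, ← hr] at hle
    rw [← hc] at h
    have hc2 : c + 1 = 3 := by exact_mod_cast h
    have hcr : c ≤ r := by exact_mod_cast hle
    omega

/-- **Nullity `5`: at most seven triangles** under (C1) and (C2) (the cap `P(5) = 7`, sharp on `M(K₅) ∖ e`). -/
theorem ncard_triangles_le_seven_of_nullity_five (M : Matroid α) [M.Finite]
    (hC1 : ∀ L ⊆ M.E, M.eRk L = 2 → L.ncard ≤ 3) (hC2 : ∀ P ⊆ M.E, M.eRk P ≤ 3 → P.ncard ≤ 6)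
    (hd : M.E.encard = M.eRank + ((5 : ℕ) : ℕ∞)) : (ThmN.triangles M).ncard ≤ 7 := by
  suffices H : ∀ n : ℕ, ∀ (M : Matroid α) [M.Finite], M.E.ncard = n →
      (∀ L ⊆ M.E, M.eRk L = 2 → L.ncard ≤ 3) → (∀ P ⊆ M.E, M.eRk P ≤ 3 → P.ncard ≤ 6) →
      M.E.encard = M.eRank + ((5 : ℕ) : ℕ∞) → (ThmN.triangles M).ncard ≤ 7 from
    H _ M rfl hC1 hC2 hd
  intro n
  induction n using Nat.strong_induction_on with
  | _ n ih =>
  intro M _ hn hC1 hC2 hd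
  classical
  by_cases hcol : ∃ k ∈ M.E, M.IsColoop k
  · -- a coloop: delete it and use the induction hypothesis
    obtain ⟨k, hkE, hk⟩ := hcol
    have hlt : (M ＼ {k}).E.ncard < n := by
      rw [_root_.Matroid.delete_ground, ← hn]
      exact Set.ncard_sdiff_singleton_lt_of_mem hkE M.ground_finite
    have hC1' : ∀ L ⊆ (M ＼ {k}).E, (M ＼ {k}).eRk L = 2 → L.ncard ≤ 3 := by
      intro L hL hr
      rw [_root_.Matroid.delete_ground] at hL
      rw [delete_singleton_eRk_eq hL] at hr
      exact hC1 L (hL.trans Set.sdiff_subset) hr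
    have hC2' : ∀ P ⊆ (M ＼ {k}).E, (M ＼ {k}).eRk P ≤ 3 → P.ncard ≤ 6 := by
      intro P hP hr
      rw [_root_.Matroid.delete_ground] at hP
      rw [delete_singleton_eRk_eq hP] at hr
      exact hC2 P (hP.trans Set.sdiff_subset) hr
    have hd' : (M ＼ {k}).E.encard = (M ＼ {k}).eRank + ((5 : ℕ) : ℕ∞) :=
      encard_delete_eq_of_isColoop M hk hd
    have := ih _ hlt (M ＼ {k}) rfl hC1' hC2' hd'
    rwa [triangles_delete_eq_of_isColoop M hk] at this
  · have hcol' : ∀ x ∈ M.E, ¬ M.IsColoop x := fun x hx h => hcol ⟨x, hx, h⟩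
    by_contra hgt
    have h8 : 8 ≤ (ThmN.triangles M).ncard := by omega
    have hSfin : (ThmN.triangles M).Finite :=
      M.ground_finite.finite_subsets.subset (fun C hC => hC.1.subset_ground)
    -- (A) every non-loop has degree `≤ 3` (a degree `≥ 4 = d − 1` would give `s₃ ≤ 6`)
    have hdeg3 : ∀ z, M.IsNonloop z → (ThmN.trianglesThrough M z).ncard ≤ 3 := by
      intro z hz
      by_contra h
      have h4 : 5 ≤ (ThmN.trianglesThrough M z).ncard + 1 := by omega
      have := ncard_triangles_le_succ_of_degree M hC1 hC2 hd hz h4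
      omega
    -- (B) every point `x` has `s₃ ≤ t(x) + 5`: `M ＼ {x}` has nullity `4`
    have hB : ∀ x ∈ M.E, (ThmN.triangles M).ncard ≤ (ThmN.trianglesThrough M x).ncard + 5 := by
      intro x hxE
      obtain ⟨hd', hC1', hC2', hle⟩ :=
        ncard_triangles_le_add_of_not_isColoop M hC1 hC2 (d := 4) hd hxE (hcol' x hxE)
      have h5 := ncard_triangles_le_five_of_nullity_four (M ＼ {x}) hC1' hC2' hd'
      omega
    -- (C) every point lies on at least three triangles
    have hdeg_ge : ∀ x ∈ M.E, 3 ≤ (ThmN.trianglesThrough M x).ncard := by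
      intro x hx
      have := hB x hx
      omega
    -- (D) a triangle exists; its points are non-loops, so `s₃ ≤ 3 + 5`
    obtain ⟨C, hC⟩ : (ThmN.triangles M).Nonempty := by
      rw [← Set.ncard_pos hSfin]; omega
    obtain ⟨x, hxC⟩ := hC.1.nonempty
    have hxE : x ∈ M.E := hC.1.subset_ground hxC
    have hx : M.IsNonloop x := by
      rw [← _root_.Matroid.indep_singleton]
      refine hC.1.ssubset_indep ?_
      refine (Set.singleton_subset_iff.2 hxC).ssubset_of_ne ?_
      intro h
      have := congrArg Set.ncard h
      rw [Set.ncard_singleton, hC.2] at this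
      omega
    have hle8 : (ThmN.triangles M).ncard ≤ 8 := by
      have := hB x hxE
      have := hdeg3 x hx
      omega
    -- (E) the double count: `3·|E| ≤ 3·s₃ ≤ 24`
    have hE := mul_ncard_ground_le_three_mul_ncard_triangles M 3 hdeg_ge
    -- (F) `r(E) = |E| − 5 ≤ 3`, so `|E| ≤ 6` by (C2), so `r(E) ≤ 1` — against the triangle
    obtain ⟨r, hr, hnr, hr2⟩ := two_add_le_eRank_of_triangle M hd hC
    have hr3 : r ≤ 3 := by omega
    have h6 : M.E.ncard ≤ 6 := by
      refine hC2 M.E (subset_refl _) ?_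
      rw [← _root_.Matroid.eRank_def, hr]
      exact_mod_cast hr3
    omega

/-- **Nullity `6`: at most ten triangles** under (C1) and (C2) (the cap `P(6) = 10`, sharp on `M(K₅)`). -/
theorem ncard_triangles_le_ten_of_nullity_six (M : Matroid α) [M.Finite]
    (hC1 : ∀ L ⊆ M.E, M.eRk L = 2 → L.ncard ≤ 3) (hC2 : ∀ P ⊆ M.E, M.eRk P ≤ 3 → P.ncard ≤ 6)
    (hd : M.E.encard = M.eRank + ((6 : ℕ) : ℕ∞)) : (ThmN.triangles M).ncard ≤ 10 := by
  suffices H : ∀ n : ℕ, ∀ (M : Matroid α) [M.Finite], M.E.ncard = n →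
      (∀ L ⊆ M.E, M.eRk L = 2 → L.ncard ≤ 3) → (∀ P ⊆ M.E, M.eRk P ≤ 3 → P.ncard ≤ 6) →
      M.E.encard = M.eRank + ((6 : ℕ) : ℕ∞) → (ThmN.triangles M).ncard ≤ 10 from
    H _ M rfl hC1 hC2 hd
  intro n
  induction n using Nat.strong_induction_on with
  | _ n ih =>
  intro M _ hn hC1 hC2 hd
  classical
  by_cases hcol : ∃ k ∈ M.E, M.IsColoop k
  · obtain ⟨k, hkE, hk⟩ := hcol
    have hlt : (M ＼ {k}).E.ncard < n := by
      rw [_root_.Matroid.delete_ground, ← hn]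
      exact Set.ncard_sdiff_singleton_lt_of_mem hkE M.ground_finite
    have hC1' : ∀ L ⊆ (M ＼ {k}).E, (M ＼ {k}).eRk L = 2 → L.ncard ≤ 3 := by
      intro L hL hr
      rw [_root_.Matroid.delete_ground] at hL
      rw [delete_singleton_eRk_eq hL] at hr
      exact hC1 L (hL.trans Set.sdiff_subset) hr
    have hC2' : ∀ P ⊆ (M ＼ {k}).E, (M ＼ {k}).eRk P ≤ 3 → P.ncard ≤ 6 := by
      intro P hP hr
      rw [_root_.Matroid.delete_ground] at hP
      rw [delete_singleton_eRk_eq hP] at hr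
      exact hC2 P (hP.trans Set.sdiff_subset) hr
    have hd' : (M ＼ {k}).E.encard = (M ＼ {k}).eRank + ((6 : ℕ) : ℕ∞) :=
      encard_delete_eq_of_isColoop M hk hd
    have := ih _ hlt (M ＼ {k}) rfl hC1' hC2' hd'
    rwa [triangles_delete_eq_of_isColoop M hk] at this
  · have hcol' : ∀ x ∈ M.E, ¬ M.IsColoop x := fun x hx h => hcol ⟨x, hx, h⟩
    by_contra hgt
    have h11 : 11 ≤ (ThmN.triangles M).ncard := by omega
    have hSfin : (ThmN.triangles M).Finite :=
      M.ground_finite.finite_subsets.subset (fun C hC => hC.1.subset_ground)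
    -- (A) every non-loop has degree `≤ 4`
    have hdeg4 : ∀ z, M.IsNonloop z → (ThmN.trianglesThrough M z).ncard ≤ 4 := by
      intro z hz
      by_contra h
      have h5 : 6 ≤ (ThmN.trianglesThrough M z).ncard + 1 := by omega
      have := ncard_triangles_le_succ_of_degree M hC1 hC2 hd hz h5
      omega
    -- (B) every point `x` has `s₃ ≤ t(x) + 7`: `M ＼ {x}` has nullity `5`
    have hB : ∀ x ∈ M.E, (ThmN.triangles M).ncard ≤ (ThmN.trianglesThrough M x).ncard + 7 := by
      intro x hxE
      obtain ⟨hd', hC1', hC2', hle⟩ :=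
        ncard_triangles_le_add_of_not_isColoop M hC1 hC2 (d := 5) hd hxE (hcol' x hxE)
      have h7 := ncard_triangles_le_seven_of_nullity_five (M ＼ {x}) hC1' hC2' hd'
      omega
    -- (C) every point lies on at least four triangles
    have hdeg_ge : ∀ x ∈ M.E, 4 ≤ (ThmN.trianglesThrough M x).ncard := by
      intro x hx
      have := hB x hx
      omega
    -- (D) a triangle exists; `s₃ ≤ 4 + 7`
    obtain ⟨C, hC⟩ : (ThmN.triangles M).Nonempty := by
      rw [← Set.ncard_pos hSfin]; omega
    obtain ⟨x, hxC⟩ := hC.1.nonempty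
    have hxE : x ∈ M.E := hC.1.subset_ground hxC
    have hx : M.IsNonloop x := by
      rw [← _root_.Matroid.indep_singleton]
      refine hC.1.ssubset_indep ?_
      refine (Set.singleton_subset_iff.2 hxC).ssubset_of_ne ?_
      intro h
      have := congrArg Set.ncard h
      rw [Set.ncard_singleton, hC.2] at this
      omega
    have hle11 : (ThmN.triangles M).ncard ≤ 11 := by
      have := hB x hxE
      have := hdeg4 x hx
      omega
    -- (E) the double count: `4·|E| ≤ 3·s₃ ≤ 33`, so `|E| ≤ 8`
    have hE := mul_ncard_ground_le_three_mul_ncard_triangles M 4 hdeg_ge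
    -- (F) `r(E) = |E| − 6 ≤ 2`, so `|E| ≤ 6` by (C2), so `r(E) ≤ 0` — against the triangle
    obtain ⟨r, hr, hnr, hr2⟩ := two_add_le_eRank_of_triangle M hd hC
    have hr3 : r ≤ 3 := by omega
    have h6 : M.E.ncard ≤ 6 := by
      refine hC2 M.E (subset_refl _) ?_
      rw [← _root_.Matroid.eRank_def, hr]
      exact_mod_cast hr3
    omega

/-- **The cap `P(5) = 7` on the `e`-free core**, in the vocabulary of `S1RowTwelve`: an `e`-free core of
nullity `5` has at most `7` triangles. -/
theorem core_ncard_triangles_le_seven_of_nullity_five (M : Matroid α) [M.Finite]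
    (hfree : ∀ e ∈ M.E, ∃ A ⊆ M.E \ {e}, e ∉ M.closure A ∧ e ∉ M.closure ((M.E \ {e}) \ A))
    (hd : M.E.encard = M.eRank + ((5 : ℕ) : ℕ∞)) :
    {C : Set α | M.IsCircuit C ∧ C.ncard = 3}.ncard ≤ 7 := by
  have hL : ∀ e ∈ M.E, ¬ M.IsLoop e := ThmN.not_isLoop_of_free M hfree
  have hline : ∀ L ⊆ M.E, M.eRk L = 2 → L.ncard ≤ 3 := by
    intro L hL' hr
    have := ThmN.ncard_add_one_le_two_pow_of_eRk_le M hL hfree 2 L hL' hr.le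
    omega
  have hplane : ∀ P ⊆ M.E, M.eRk P ≤ 3 → P.ncard ≤ 6 := fun P hP hr =>
    ThmN.ncard_le_six_of_eRk_le_three_of_free M hfree hP hr
  exact ncard_triangles_le_seven_of_nullity_five M hline hplane hd

/-- **The cap `P(6) = 10` on the `e`-free core**: an `e`-free core of nullity `6` has at most `10` triangles. -/
theorem core_ncard_triangles_le_ten_of_nullity_six (M : Matroid α) [M.Finite]
    (hfree : ∀ e ∈ M.E, ∃ A ⊆ M.E \ {e}, e ∉ M.closure A ∧ e ∉ M.closure ((M.E \ {e}) \ A))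
    (hd : M.E.encard = M.eRank + ((6 : ℕ) : ℕ∞)) :
    {C : Set α | M.IsCircuit C ∧ C.ncard = 3}.ncard ≤ 10 := by
  have hL : ∀ e ∈ M.E, ¬ M.IsLoop e := ThmN.not_isLoop_of_free M hfree
  have hline : ∀ L ⊆ M.E, M.eRk L = 2 → L.ncard ≤ 3 := by
    intro L hL' hr
    have := ThmN.ncard_add_one_le_two_pow_of_eRk_le M hL hfree 2 L hL' hr.le
    omega
  have hplane : ∀ P ⊆ M.E, M.eRk P ≤ 3 → P.ncard ≤ 6 := fun P hP hr =>
    ThmN.ncard_le_six_of_eRk_le_three_of_free M hfree hP hr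
  exact ncard_triangles_le_ten_of_nullity_six M hline hplane hd

end S1

end PercRepro
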